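import Literature.Analysis.SegalBargmann.SchwartzTensorSchurTransport
import HarnessLib

/-!
# The two-factor Schur lemma for PROJECTIVELY covariant operators (Folland 1989, §1.4/§1.7)

Topic `Analysis/SegalBargmann`; namespace `Literature.Analysis.SegalBargmann`.  The two-factor Schur lemma of
`SchwartzTensorSchur` / `SchwartzTensorOperators` / `SchwartzTensorSchurTransport` asks for PHASE-FREE covariance
`A ρ(v) = ρ(s v) A`.  An implementer of a symplectic map on Weil's Heisenberg group `(w, t)·(w', t') =
(w + w', t + t' + ⟨x, y'⟩)` is phase-free only on the symmetric section `(w, ½⟨x, y⟩)`; on the operators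
`ρ(w, 0)` — and on Folland's `ρ(p, q)` after a change of coordinates that is a symplectic SIMILITUDE — it is covariant
up to a nowhere-vanishing scalar cocycle: `A ρ(v) = χ(v) • ρ(s v) A`.  This file records that the whole argument is
insensitive to such cocycles provided the cocycle of the big implementer is the PRODUCT of the two small ones
(`blockChar χ₁ χ₂`), which is what additivity of Weil's quadratic form over an orthogonal direct sum gives:

* §1 `blockChar`, and `tensor_covariant_proj`: `T (f ⊠ g) = A₁ f ⊠ A₂ g` and `A_j ρ(v) = χ_j(v) • ρ(s_j v) A_j`
  ⇒ `T ρ(V) = blockChar χ₁ χ₂ (V) • ρ(blockPhase s₁ s₂ V) T`;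
* §2 **`eq_smul_of_tensor_covariant_proj`**: if moreover `M ρ(V) = blockChar χ₁ χ₂ (V) • ρ(blockPhase s₁ s₂ V) M`
  with `χ_j` nowhere zero, then `T = c • M`; `exists_ne_zero_smul_tensorOp_proj` (statement of record with the
  constructed extension `tensorOp`), and the transported forms `exists_ne_zero_smul_tensorD_proj`,
  `exists_ne_zero_smul_piBoxTensor_proj` (function carriers `𝓢((ι₁ ⊕ ι₂) → V)`).

Everything is proved from the imported tree files; no cited statement is used as a hypothesis.

## References

* [Folland1989] G. B. Folland, *Harmonic Analysis in Phase Space*, Princeton UP (1989), §1.4 Prop. (1.43), §1.7.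
  [cite: Folland1989, §1.7]
* [Weil1964] A. Weil, *Sur certains groupes d'opérateurs unitaires*, Acta Math. 111 (1964), n° 4–5 (the cocycle
  `F` and the section `σ ↦ (σ, f_σ)`).

## Provenance

LEAN-IN-TREE rule (2026-08-18), pub-hodgecm model-construction sub-cell, seat mc-binder-2 gen 3 (node W2-⊗ (⊗S),
input of the (⊗S)-𝔸 (iii) assembly).
-/

set_option autoImplicit false

noncomputable section

open MeasureTheory Complex SchwartzMap Filter Topology
open scoped BigOperators Real

namespace Literature.Analysis.SegalBargmann

local notation "SR" σ:max => (SchwartzMap (σ → ℝ) ℂ)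
local notation "SD" D:max => (SchwartzMap D ℂ)

/-! ## §1  Block cocycles and projective covariance of the extension -/

section BlockChar

variable {σ₁ σ₂ : Type*}

/-- **The product cocycle** of `χ₁` on `(σ₁ → ℝ)²` and `χ₂` on `(σ₂ → ℝ)²`, a function on `((σ₁ ⊕ σ₂) → ℝ)²`.
[folklore] -/
def blockChar (χ₁ : (σ₁ → ℝ) × (σ₁ → ℝ) → ℂ) (χ₂ : (σ₂ → ℝ) × (σ₂ → ℝ) → ℂ) :
    (σ₁ ⊕ σ₂ → ℝ) × (σ₁ ⊕ σ₂ → ℝ) → ℂ := fun PQ =>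
  χ₁ (PQ.1 ∘ Sum.inl, PQ.2 ∘ Sum.inl) * χ₂ (PQ.1 ∘ Sum.inr, PQ.2 ∘ Sum.inr)

/-- The product cocycle on `Sum.elim` vectors. [folklore] -/
@[simp] theorem blockChar_elim (χ₁ : (σ₁ → ℝ) × (σ₁ → ℝ) → ℂ) (χ₂ : (σ₂ → ℝ) × (σ₂ → ℝ) → ℂ)
    (p₁ q₁ : σ₁ → ℝ) (p₂ q₂ : σ₂ → ℝ) :
    blockChar χ₁ χ₂ (Sum.elim p₁ p₂, Sum.elim q₁ q₂) = χ₁ (p₁, q₁) * χ₂ (p₂, q₂) := by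
  simp only [blockChar, Sum.elim_comp_inl, Sum.elim_comp_inr]

/-- A product of nowhere-vanishing cocycles vanishes nowhere. [folklore] -/
theorem blockChar_ne_zero {χ₁ : (σ₁ → ℝ) × (σ₁ → ℝ) → ℂ} {χ₂ : (σ₂ → ℝ) × (σ₂ → ℝ) → ℂ}
    (h₁ : ∀ v, χ₁ v ≠ 0) (h₂ : ∀ v, χ₂ v ≠ 0) (V : (σ₁ ⊕ σ₂ → ℝ) × (σ₁ ⊕ σ₂ → ℝ)) :
    blockChar χ₁ χ₂ V ≠ 0 :=
  mul_ne_zero (h₁ _) (h₂ _)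

end BlockChar

section Covariance

variable {σ₁ σ₂ : Type*} [Fintype σ₁] [Fintype σ₂] [DecidableEq σ₁] [DecidableEq σ₂]
variable {s₁ : (σ₁ → ℝ) × (σ₁ → ℝ) → (σ₁ → ℝ) × (σ₁ → ℝ)}
  {s₂ : (σ₂ → ℝ) × (σ₂ → ℝ) → (σ₂ → ℝ) × (σ₂ → ℝ)}
  {χ₁ : (σ₁ → ℝ) × (σ₁ → ℝ) → ℂ} {χ₂ : (σ₂ → ℝ) × (σ₂ → ℝ) → ℂ}

/-- **A tensor extension inherits projective block covariance**: if `A_j ρ(v) = χ_j(v) • ρ(s_j v) A_j` and the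
continuous `T` satisfies `T (f ⊠ g) = A₁ f ⊠ A₂ g`, then
`T ρ(V) = blockChar χ₁ χ₂ (V) • ρ(blockPhase s₁ s₂ V) T`. [folklore] -/
theorem tensor_covariant_proj (A₁ : (SR σ₁) →L[ℂ] SR σ₁) (A₂ : (SR σ₂) →L[ℂ] SR σ₂)
    (hA₁ : ∀ (p q : σ₁ → ℝ) (f : SR σ₁),
      A₁ (rhoS p q f) = χ₁ (p, q) • rhoS (s₁ (p, q)).1 (s₁ (p, q)).2 (A₁ f))
    (hA₂ : ∀ (p q : σ₂ → ℝ) (g : SR σ₂),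
      A₂ (rhoS p q g) = χ₂ (p, q) • rhoS (s₂ (p, q)).1 (s₂ (p, q)).2 (A₂ g))
    (T : (SR (σ₁ ⊕ σ₂)) →L[ℂ] SR (σ₁ ⊕ σ₂))
    (hT : ∀ (f : SR σ₁) (g : SR σ₂), T (tensorPi f g) = tensorPi (A₁ f) (A₂ g))
    (P Q : σ₁ ⊕ σ₂ → ℝ) (F : SR (σ₁ ⊕ σ₂)) :
    T (rhoS P Q F) =
      blockChar χ₁ χ₂ (P, Q) • rhoS (blockPhase s₁ s₂ (P, Q)).1 (blockPhase s₁ s₂ (P, Q)).2 (T F) := by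
  have key : T.comp (rhoS P Q) =
      blockChar χ₁ χ₂ (P, Q) • (rhoS (blockPhase s₁ s₂ (P, Q)).1 (blockPhase s₁ s₂ (P, Q)).2).comp T := by
    refine clm_eq_of_eq_on_tensorPi fun f g => ?_
    rw [ContinuousLinearMap.comp_apply, smul_apply, ContinuousLinearMap.comp_apply, hT,
      ← sum_elim_comp_inl_inr P, ← sum_elim_comp_inl_inr Q, rhoS_tensorPi, hT, hA₁, hA₂, blockPhase_elim,
      blockChar_elim, rhoS_tensorPi, tensorPi_smul_left, tensorPi_smul_right, smul_smul]
  exact congrArg (fun R : (SR (σ₁ ⊕ σ₂)) →L[ℂ] SR (σ₁ ⊕ σ₂) => R F) key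

/-! ## §2  The projective two-factor Schur lemma -/

/-- **Two-factor Schur lemma, projective form (operator version).** Let `M` be a continuous linear automorphism
of `𝓢(ℝ^{σ₁ ⊕ σ₂})` with `M ρ(V) = blockChar χ₁ χ₂ (V) • ρ(blockPhase s₁ s₂ V) M`, `A_j` continuous operators of
`𝓢(ℝ^{σ_j})` with `A_j ρ(v) = χ_j(v) • ρ(s_j v) A_j`, the `χ_j` nowhere zero, and `T` any continuous operator with
`T (f ⊠ g) = A₁ f ⊠ A₂ g`.  Then `T F = schurCoeff (M⁻¹ T) • M F`. [cite: Folland1989, Prop. (1.43)] -/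
theorem eq_smul_of_tensor_covariant_proj (hχ₁ : ∀ v, χ₁ v ≠ 0) (hχ₂ : ∀ v, χ₂ v ≠ 0)
    (M : (SR (σ₁ ⊕ σ₂)) ≃L[ℂ] SR (σ₁ ⊕ σ₂))
    (hM : ∀ (P Q : σ₁ ⊕ σ₂ → ℝ) (F : SR (σ₁ ⊕ σ₂)), M (rhoS P Q F) =
      blockChar χ₁ χ₂ (P, Q) • rhoS (blockPhase s₁ s₂ (P, Q)).1 (blockPhase s₁ s₂ (P, Q)).2 (M F))
    (A₁ : (SR σ₁) →L[ℂ] SR σ₁) (A₂ : (SR σ₂) →L[ℂ] SR σ₂)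
    (hA₁ : ∀ (p q : σ₁ → ℝ) (f : SR σ₁),
      A₁ (rhoS p q f) = χ₁ (p, q) • rhoS (s₁ (p, q)).1 (s₁ (p, q)).2 (A₁ f))
    (hA₂ : ∀ (p q : σ₂ → ℝ) (g : SR σ₂),
      A₂ (rhoS p q g) = χ₂ (p, q) • rhoS (s₂ (p, q)).1 (s₂ (p, q)).2 (A₂ g))
    (T : (SR (σ₁ ⊕ σ₂)) →L[ℂ] SR (σ₁ ⊕ σ₂))
    (hT : ∀ (f : SR σ₁) (g : SR σ₂), T (tensorPi f g) = tensorPi (A₁ f) (A₂ g)) (F : SR (σ₁ ⊕ σ₂)) :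
    T F = schurCoeff (((M.symm : (SR (σ₁ ⊕ σ₂)) ≃L[ℂ] SR (σ₁ ⊕ σ₂)) :
      (SR (σ₁ ⊕ σ₂)) →L[ℂ] SR (σ₁ ⊕ σ₂)).comp T) • M F := by
  set R : (SR (σ₁ ⊕ σ₂)) →L[ℂ] SR (σ₁ ⊕ σ₂) :=
    ((M.symm : (SR (σ₁ ⊕ σ₂)) ≃L[ℂ] SR (σ₁ ⊕ σ₂)) : (SR (σ₁ ⊕ σ₂)) →L[ℂ] SR (σ₁ ⊕ σ₂)).comp T with hRdef
  have hRapp : ∀ G, R G = M.symm (T G) := fun G => rfl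
  -- `M⁻¹` is covariant the other way round, with the inverse cocycle
  have hMs : ∀ (P Q : σ₁ ⊕ σ₂ → ℝ) (G : SR (σ₁ ⊕ σ₂)),
      M.symm (rhoS (blockPhase s₁ s₂ (P, Q)).1 (blockPhase s₁ s₂ (P, Q)).2 G) =
        (blockChar χ₁ χ₂ (P, Q))⁻¹ • rhoS P Q (M.symm G) := by
    intro P Q G
    apply M.injective
    rw [map_smul, hM, ContinuousLinearEquiv.apply_symm_apply, ContinuousLinearEquiv.apply_symm_apply, smul_smul,
      inv_mul_cancel₀ (blockChar_ne_zero hχ₁ hχ₂ _), one_smul]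
  -- so `R = M⁻¹ T` commutes with every `ρ(P,Q)`
  have hR : ∀ (P Q : σ₁ ⊕ σ₂ → ℝ) (G : SR (σ₁ ⊕ σ₂)), R (rhoS P Q G) = rhoS P Q (R G) := by
    intro P Q G
    rw [hRapp, hRapp, tensor_covariant_proj A₁ A₂ hA₁ hA₂ T hT, map_smul, hMs, smul_smul,
      mul_inv_cancel₀ (blockChar_ne_zero hχ₁ hχ₂ _), one_smul]
  have hS := eq_smul_of_commute_rhoS R hR F
  rw [hRapp] at hS
  have h2 := congrArg M hS
  rwa [ContinuousLinearEquiv.apply_symm_apply, map_smul] at h2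

/-- **Projective two-factor Schur lemma, statement of record with the constructed extension**: under the covariance
hypotheses of `eq_smul_of_tensor_covariant_proj` for continuous linear AUTOMORPHISMS `A_j`, there is ONE `c ≠ 0`
with `M = c • (A₁ ⊠̂ A₂)`, in particular `M (f ⊠ g) = c • (A₁ f ⊠ A₂ g)`. [cite: Folland1989, Prop. (1.43)] -/
theorem exists_ne_zero_smul_tensorOp_proj (hχ₁ : ∀ v, χ₁ v ≠ 0) (hχ₂ : ∀ v, χ₂ v ≠ 0)
    (M : (SR (σ₁ ⊕ σ₂)) ≃L[ℂ] SR (σ₁ ⊕ σ₂))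
    (hM : ∀ (P Q : σ₁ ⊕ σ₂ → ℝ) (F : SR (σ₁ ⊕ σ₂)), M (rhoS P Q F) =
      blockChar χ₁ χ₂ (P, Q) • rhoS (blockPhase s₁ s₂ (P, Q)).1 (blockPhase s₁ s₂ (P, Q)).2 (M F))
    (A₁ : (SR σ₁) ≃L[ℂ] SR σ₁) (A₂ : (SR σ₂) ≃L[ℂ] SR σ₂)
    (hA₁ : ∀ (p q : σ₁ → ℝ) (f : SR σ₁),
      A₁ (rhoS p q f) = χ₁ (p, q) • rhoS (s₁ (p, q)).1 (s₁ (p, q)).2 (A₁ f))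
    (hA₂ : ∀ (p q : σ₂ → ℝ) (g : SR σ₂),
      A₂ (rhoS p q g) = χ₂ (p, q) • rhoS (s₂ (p, q)).1 (s₂ (p, q)).2 (A₂ g)) :
    ∃ c : ℂ, c ≠ 0 ∧ (∀ F, M F = c • tensorOp (A₁ : (SR σ₁) →L[ℂ] SR σ₁) (A₂ : (SR σ₂) →L[ℂ] SR σ₂) F) ∧
      ∀ (f : SR σ₁) (g : SR σ₂), M (tensorPi f g) = c • tensorPi (A₁ f) (A₂ g) := by
  set c₀ := schurCoeff (((M.symm : (SR (σ₁ ⊕ σ₂)) ≃L[ℂ] SR (σ₁ ⊕ σ₂)) :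
      (SR (σ₁ ⊕ σ₂)) →L[ℂ] SR (σ₁ ⊕ σ₂)).comp (tensorOp (A₁ : (SR σ₁) →L[ℂ] SR σ₁) (A₂ : (SR σ₂) →L[ℂ] SR σ₂)))
  have hc : ∀ F, tensorOp (A₁ : (SR σ₁) →L[ℂ] SR σ₁) (A₂ : (SR σ₂) →L[ℂ] SR σ₂) F = c₀ • M F := fun F =>
    eq_smul_of_tensor_covariant_proj hχ₁ hχ₂ M hM _ _ hA₁ hA₂ _ (tensorOp_tensorPi _ _) F
  have hc0 : c₀ ≠ 0 := by
    intro h0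
    have h1 := hc (tensorPi (A₁.symm (hermitePi 0)) (A₂.symm (hermitePi 0)))
    rw [h0, zero_smul, tensorOp_tensorPi] at h1
    have h2 : tensorPi (hermitePi (0 : σ₁ →₀ ℕ) : SR σ₁) (hermitePi (0 : σ₂ →₀ ℕ) : SR σ₂) = 0 := by
      simpa only [ContinuousLinearEquiv.coe_coe, ContinuousLinearEquiv.apply_symm_apply] using h1
    exact tensorPi_ne_zero (hermitePi_ne_zero 0) (hermitePi_ne_zero 0) h2
  refine ⟨c₀⁻¹, inv_ne_zero hc0, fun F => ?_, fun f g => ?_⟩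
  · rw [hc F, smul_smul, inv_mul_cancel₀ hc0, one_smul]
  · have h1 := hc (tensorPi f g)
    rw [tensorOp_tensorPi] at h1
    simp only [ContinuousLinearEquiv.coe_coe] at h1
    rw [h1, smul_smul, inv_mul_cancel₀ hc0, one_smul]

end Covariance

/-! ## §3  Transported and function-carrier forms -/

section Transport

variable {σ₁ σ₂ : Type*} [Fintype σ₁] [Fintype σ₂] [DecidableEq σ₁] [DecidableEq σ₂]
variable {D₁ D₂ D : Type*} [NormedAddCommGroup D₁] [NormedSpace ℝ D₁] [NormedAddCommGroup D₂] [NormedSpace ℝ D₂]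
  [NormedAddCommGroup D] [NormedSpace ℝ D]
variable (e₁ : D₁ ≃L[ℝ] (σ₁ → ℝ)) (e₂ : D₂ ≃L[ℝ] (σ₂ → ℝ)) (e : D ≃L[ℝ] (σ₁ ⊕ σ₂ → ℝ))
variable {s₁ : (σ₁ → ℝ) × (σ₁ → ℝ) → (σ₁ → ℝ) × (σ₁ → ℝ)}
  {s₂ : (σ₂ → ℝ) × (σ₂ → ℝ) → (σ₂ → ℝ) × (σ₂ → ℝ)}
  {χ₁ : (σ₁ → ℝ) × (σ₁ → ℝ) → ℂ} {χ₂ : (σ₂ → ℝ) × (σ₂ → ℝ) → ℂ}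

/-- Projective covariance transports along `conjS`. [folklore] -/
theorem conjS_rhoS_proj {D' : Type*} [NormedAddCommGroup D'] [NormedSpace ℝ D'] {σ : Type*} [Fintype σ]
    (e' : D' ≃L[ℝ] (σ → ℝ)) {s : (σ → ℝ) × (σ → ℝ) → (σ → ℝ) × (σ → ℝ)} {χ : (σ → ℝ) × (σ → ℝ) → ℂ}
    (A : (SD D') →L[ℂ] SD D')
    (hA : ∀ (p q : σ → ℝ) (f : SD D'), A (rhoSD e' p q f) = χ (p, q) • rhoSD e' (s (p, q)).1 (s (p, q)).2 (A f))
    (p q : σ → ℝ) (f : SR σ) :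
    conjS e' A (rhoS p q f) = χ (p, q) • rhoS (s (p, q)).1 (s (p, q)).2 (conjS e' A f) := by
  rw [conjS_apply, conjS_apply, schwartzTransport_symm_rhoS, hA, map_smul, schwartzTransport_rhoSD]

/-- **Projective two-factor Schur lemma on transported carriers** `𝓢(D_j)`, `𝓢(D)`. [cite: Folland1989, Prop. (1.43)] -/
theorem exists_ne_zero_smul_tensorD_proj (hχ₁ : ∀ v, χ₁ v ≠ 0) (hχ₂ : ∀ v, χ₂ v ≠ 0)
    (M : (SD D) ≃L[ℂ] SD D)
    (hM : ∀ (P Q : σ₁ ⊕ σ₂ → ℝ) (F : SD D), M (rhoSD e P Q F) =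
      blockChar χ₁ χ₂ (P, Q) • rhoSD e (blockPhase s₁ s₂ (P, Q)).1 (blockPhase s₁ s₂ (P, Q)).2 (M F))
    (A₁ : (SD D₁) ≃L[ℂ] SD D₁) (A₂ : (SD D₂) ≃L[ℂ] SD D₂)
    (hA₁ : ∀ (p q : σ₁ → ℝ) (f : SD D₁),
      A₁ (rhoSD e₁ p q f) = χ₁ (p, q) • rhoSD e₁ (s₁ (p, q)).1 (s₁ (p, q)).2 (A₁ f))
    (hA₂ : ∀ (p q : σ₂ → ℝ) (g : SD D₂),
      A₂ (rhoSD e₂ p q g) = χ₂ (p, q) • rhoSD e₂ (s₂ (p, q)).1 (s₂ (p, q)).2 (A₂ g)) :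
    ∃ c : ℂ, c ≠ 0 ∧
      (∀ F, M F = c • tensorOpD e₁ e₂ e (A₁ : (SD D₁) →L[ℂ] SD D₁) (A₂ : (SD D₂) →L[ℂ] SD D₂) F) ∧
      ∀ (f : SD D₁) (g : SD D₂), M (tensorD e₁ e₂ e f g) = c • tensorD e₁ e₂ e (A₁ f) (A₂ g) := by
  set M' : (SR (σ₁ ⊕ σ₂)) ≃L[ℂ] SR (σ₁ ⊕ σ₂) :=
    ((schwartzTransport e).symm.trans M).trans (schwartzTransport e) with hM'
  set A₁' : (SR σ₁) ≃L[ℂ] SR σ₁ := ((schwartzTransport e₁).symm.trans A₁).trans (schwartzTransport e₁) with hA₁'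
  set A₂' : (SR σ₂) ≃L[ℂ] SR σ₂ := ((schwartzTransport e₂).symm.trans A₂).trans (schwartzTransport e₂) with hA₂'
  have hM'app : ∀ G, M' G = schwartzTransport e (M ((schwartzTransport e).symm G)) := fun G => rfl
  have hA₁'c : (A₁' : (SR σ₁) →L[ℂ] SR σ₁) = conjS e₁ (A₁ : (SD D₁) →L[ℂ] SD D₁) :=
    ContinuousLinearMap.ext fun f => rfl
  have hA₂'c : (A₂' : (SR σ₂) →L[ℂ] SR σ₂) = conjS e₂ (A₂ : (SD D₂) →L[ℂ] SD D₂) :=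
    ContinuousLinearMap.ext fun f => rfl
  have hM'cov : ∀ (P Q : σ₁ ⊕ σ₂ → ℝ) (G : SR (σ₁ ⊕ σ₂)), M' (rhoS P Q G) =
      blockChar χ₁ χ₂ (P, Q) • rhoS (blockPhase s₁ s₂ (P, Q)).1 (blockPhase s₁ s₂ (P, Q)).2 (M' G) :=
    fun P Q G => by
    rw [hM'app, hM'app, schwartzTransport_symm_rhoS, hM, map_smul, schwartzTransport_rhoSD]
  have hA₁'cov : ∀ (p q : σ₁ → ℝ) (f : SR σ₁),
      A₁' (rhoS p q f) = χ₁ (p, q) • rhoS (s₁ (p, q)).1 (s₁ (p, q)).2 (A₁' f) := fun p q f => by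
    have h := conjS_rhoS_proj e₁ (A₁ : (SD D₁) →L[ℂ] SD D₁) hA₁ p q f
    rwa [← hA₁'c] at h
  have hA₂'cov : ∀ (p q : σ₂ → ℝ) (g : SR σ₂),
      A₂' (rhoS p q g) = χ₂ (p, q) • rhoS (s₂ (p, q)).1 (s₂ (p, q)).2 (A₂' g) := fun p q g => by
    have h := conjS_rhoS_proj e₂ (A₂ : (SD D₂) →L[ℂ] SD D₂) hA₂ p q g
    rwa [← hA₂'c] at h
  obtain ⟨c, hc0, hcF, -⟩ := exists_ne_zero_smul_tensorOp_proj hχ₁ hχ₂ M' hM'cov A₁' A₂' hA₁'cov hA₂'cov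
  have key : ∀ F : SD D, M F = c • tensorOpD e₁ e₂ e (A₁ : (SD D₁) →L[ℂ] SD D₁) (A₂ : (SD D₂) →L[ℂ] SD D₂) F := by
    intro F
    have h1 := hcF (schwartzTransport e F)
    rw [hM'app, ContinuousLinearEquiv.symm_apply_apply, hA₁'c, hA₂'c] at h1
    have h2 := congrArg (schwartzTransport e).symm h1
    rw [ContinuousLinearEquiv.symm_apply_apply, map_smul] at h2
    rw [h2, tensorOpD, ContinuousLinearMap.comp_apply, ContinuousLinearMap.comp_apply]
    rfl
  refine ⟨c, hc0, key, fun f g => ?_⟩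
  rw [key, tensorOpD_tensorD]
  rfl

end Transport

section FunctionCarrier

variable {V : Type*} [NormedAddCommGroup V] [NormedSpace ℝ V] {τ : Type*} [Fintype τ] (b : Module.Basis τ ℝ V)
variable {ι₁ ι₂ : Type*} [Fintype ι₁] [Fintype ι₂]
variable {s₁ : (ι₁ × τ → ℝ) × (ι₁ × τ → ℝ) → (ι₁ × τ → ℝ) × (ι₁ × τ → ℝ)}
  {s₂ : (ι₂ × τ → ℝ) × (ι₂ × τ → ℝ) → (ι₂ × τ → ℝ) × (ι₂ × τ → ℝ)}
  {χ₁ : (ι₁ × τ → ℝ) × (ι₁ × τ → ℝ) → ℂ} {χ₂ : (ι₂ × τ → ℝ) × (ι₂ × τ → ℝ) → ℂ}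

/-- **Projective two-factor Schur lemma on function carriers `𝓢((ι₁ ⊕ ι₂) → V)`** (basis coordinates
`piCarrierEquiv b`, `sumCarrierEquiv b`; `⊠ = piBoxTensor`). [cite: Folland1989, Prop. (1.43)] -/
theorem exists_ne_zero_smul_piBoxTensor_proj (hχ₁ : ∀ v, χ₁ v ≠ 0) (hχ₂ : ∀ v, χ₂ v ≠ 0)
    (M : (SD (ι₁ ⊕ ι₂ → V)) ≃L[ℂ] SD (ι₁ ⊕ ι₂ → V))
    (hM : ∀ (P Q : (ι₁ × τ) ⊕ (ι₂ × τ) → ℝ) (F : SD (ι₁ ⊕ ι₂ → V)),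
      M (rhoSD (sumCarrierEquiv b ι₁ ι₂) P Q F) =
        blockChar χ₁ χ₂ (P, Q) • rhoSD (sumCarrierEquiv b ι₁ ι₂) (blockPhase s₁ s₂ (P, Q)).1
          (blockPhase s₁ s₂ (P, Q)).2 (M F))
    (A₁ : (SD (ι₁ → V)) ≃L[ℂ] SD (ι₁ → V)) (A₂ : (SD (ι₂ → V)) ≃L[ℂ] SD (ι₂ → V))
    (hA₁ : ∀ (p q : ι₁ × τ → ℝ) (f : SD (ι₁ → V)), A₁ (rhoSD (piCarrierEquiv b ι₁) p q f) =
      χ₁ (p, q) • rhoSD (piCarrierEquiv b ι₁) (s₁ (p, q)).1 (s₁ (p, q)).2 (A₁ f))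
    (hA₂ : ∀ (p q : ι₂ × τ → ℝ) (g : SD (ι₂ → V)), A₂ (rhoSD (piCarrierEquiv b ι₂) p q g) =
      χ₂ (p, q) • rhoSD (piCarrierEquiv b ι₂) (s₂ (p, q)).1 (s₂ (p, q)).2 (A₂ g)) :
    ∃ c : ℂ, c ≠ 0 ∧ ∀ (f : SD (ι₁ → V)) (g : SD (ι₂ → V)),
      M (piBoxTensor f g) = c • piBoxTensor (A₁ f) (A₂ g) := by
  classical
  obtain ⟨c, hc0, -, h⟩ := exists_ne_zero_smul_tensorD_proj (piCarrierEquiv b ι₁) (piCarrierEquiv b ι₂)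
    (sumCarrierEquiv b ι₁ ι₂) hχ₁ hχ₂ M hM A₁ A₂ hA₁ hA₂
  refine ⟨c, hc0, fun f g => ?_⟩
  rw [piBoxTensor_eq_tensorD b, piBoxTensor_eq_tensorD b, h]

end FunctionCarrier

end Literature.Analysis.SegalBargmann

end
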